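import Mathlib
import Summits.MatrixMultiplication.MatrixMultiplication.Theses.MatrixPointInterpolation

/-!
# Crux-ideate (round 1, k1) sketch for `MatrixPointInterpolation.LongMasquerade`
# (stmt-MatrixMultiplication-18938): the FIVE-POINT CORNER

Idea `five-point-corner`: the crux as typed is PROVABLE with point size `k = 5`, witnessed at
every size `n` by the nilpotent shift/corner pair `A = (N, E_{1n})` with `d = 2n`.

* Claim 1 (`stub_fewLetters_identity_trivial`, folklore): a two-letter identity of `M_k(ℂ)` in
  which every word carries fewer than `k` letters `y` is FORMALLY zero (all coefficients vanish):
  evaluate at `x = diag(λ₀,…,λ_{k-1})`, `y = Σ E_{t,t+1}`; entry `(0,j)` of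
  `Σ_a c_a x^{a₀} y x^{a₁} ⋯ y x^{a_j}` is the polynomial `Σ_a c_a λ₀^{a₀}⋯λ_j^{a_j}`, which must
  vanish on `ℂ^{j+1}` (`j+1 ≤ k`), so `c = 0`.
* Claim 2 (`stub_cornerWords_vanish`): `E_{1n} N^m E_{1n} = [m = n-1]·E_{1n}`, so a non-zero word
  with `j` corner letters has length `≥ j + (j-1)(n-1)`; every word with `≥ k` corner letters and
  length `≤ (k-1)·n` vanishes.
* `stub_identity_split_by_count`: identities of `M_k` split into `y`-degree components (scale
  `y ↦ t·y`, polynomial in `t` with infinitely many roots).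
* `stub_corner_generates`: `E_{pq} = N^{p-1} E_{1n} N^{n-q}` has length `≤ 2n-1 ≤ d`.
* `longMasquerade_of_corner` (PROVED below from the four stubs): with `k = 5`, `d = 2n`, the
  window `2d = 4n = (k-1)·n` carries only identities whose `y`-degree-`< 5` part is formally zero
  and whose `y`-degree-`≥ 5` words vanish at `A`.

The same witness REFUTES the sister crux `TightWindows` (item 18939) at `k = 5`
(`tightWindows_false_of_corner`, typed only): the window functions of length `≤ 4n` on `M₅²`
contain the `n⁴` independent functions `x^{a₀} y x^{a₁} y x^{a₂} y x^{a₃} y`, `aᵢ < n`.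
-/

namespace Summit.MatrixMultiplication.MatrixMultiplication.Cruxes.LongMasquerade.FivePointCorner

open scoped BigOperators
open Matrix
open Summit.MatrixMultiplication.MatrixMultiplication.Theses.MatrixPointInterpolation

/-- The subdiagonal nilpotent shift `N e_i = e_{i+1}` (`N_{i,j} = [i = j+1]`). -/
def shiftN (n : ℕ) : Matrix (Fin n) (Fin n) ℂ :=
  fun i j => if (i : ℕ) = (j : ℕ) + 1 then 1 else 0

/-- The corner matrix unit `E_{1n}` (0-indexed `E_{0,n-1}`). -/
def cornerE (n : ℕ) : Matrix (Fin n) (Fin n) ℂ :=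
  fun i j => if (i : ℕ) = 0 ∧ (j : ℕ) = n - 1 then 1 else 0

/-- The five-point corner pair `(N, E_{1n})`. -/
def cornerPair (n : ℕ) : Fin 2 → Matrix (Fin n) (Fin n) ℂ := ![shiftN n, cornerE n]

/-- FIRST LEMMA (Claim 1, folklore; the load-bearing PI fact): a two-letter identity of `M_k(ℂ)`
all of whose words carry fewer than `k` letters `1` (= `y`) is formally zero. -/
theorem stub_fewLetters_identity_trivial (k : ℕ) (T : Finset (List (Fin 2)))
    (c : List (Fin 2) → ℂ) (hfew : ∀ w ∈ T, w.count 1 < k)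
    (hid : ∀ B : Fin 2 → Matrix (Fin k) (Fin k) ℂ, (∑ w ∈ T, c w • (w.map B).prod) = 0) :
    ∀ w ∈ T, c w = 0 := by
  sorry

/-- `y`-degree splitting: each `y`-degree component of a two-letter identity of `M_k(ℂ)` is again
an identity (scaling `B 1 ↦ t • B 1`, a matrix-valued polynomial in `t` vanishing on `ℂ`). -/
theorem stub_identity_split_by_count (k : ℕ) (T : Finset (List (Fin 2)))
    (c : List (Fin 2) → ℂ)
    (hid : ∀ B : Fin 2 → Matrix (Fin k) (Fin k) ℂ, (∑ w ∈ T, c w • (w.map B).prod) = 0)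
    (j : ℕ) :
    ∀ B : Fin 2 → Matrix (Fin k) (Fin k) ℂ,
      (∑ w ∈ T.filter (fun w => w.count 1 = j), c w • (w.map B).prod) = 0 := by
  sorry

/-- Claim 2 (gap law `E_{1n} N^m E_{1n} = [m = n-1] E_{1n}`): a word with at least `k` corner
letters and length `≤ (k-1)·n` vanishes at the corner pair. -/
theorem stub_cornerWords_vanish (n k : ℕ) (w : List (Fin 2)) (hk : k ≤ w.count 1)
    (hlen : w.length ≤ (k - 1) * n) : (w.map (cornerPair n)).prod = 0 := by
  sorry

/-- Generation: `E_{pq} = N^{p-1} E_{1n} N^{n-q}` is a word of length `≤ 2n - 1`, so words of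
length `≤ 2n` span `M_n`. -/
theorem stub_corner_generates (n : ℕ) (hn : 1 ≤ n) :
    Submodule.span ℂ {M : Matrix (Fin n) (Fin n) ℂ |
      ∃ w : List (Fin 2), w.length ≤ 2 * n ∧ (w.map (cornerPair n)).prod = M} = ⊤ := by
  sorry

/-- COMPOSITION (kernel-checked from the four stubs): `LongMasquerade` holds with `k = 5`,
`n = max n₀ 1`, `d = 2n`, `A = (N, E_{1n})`. -/
theorem longMasquerade_of_corner : LongMasquerade := by
  refine ⟨5, by norm_num, fun n₀ => ?_⟩
  refine ⟨max n₀ 1, 2 * max n₀ 1, cornerPair (max n₀ 1), le_max_left _ _,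
    stub_corner_generates _ (le_max_right _ _), ?_⟩
  intro T c hT hid
  apply Finset.sum_eq_zero
  intro w hw
  by_cases hc : w.count 1 < 5
  · have hsplit := stub_identity_split_by_count 5 T c hid (w.count 1)
    have hzero := stub_fewLetters_identity_trivial 5 (T.filter fun w' => w'.count 1 = w.count 1) c
      (by
        intro w' hw'
        rw [Finset.mem_filter] at hw'
        rw [hw'.2]
        exact hc) hsplit w (by rw [Finset.mem_filter]; exact ⟨hw, rfl⟩)
    rw [hzero, zero_smul]
  · push Not at hc
    have hl := hT w hw
    rw [stub_cornerWords_vanish _ 5 w hc (by omega), smul_zero]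

/-! ## The same witness against `TightWindows` (item 18939) — typed only, for the tenure planner -/

/-- Lower bound on the window dimension at `k = 5`: the `n⁴` word functions
`x^{a₀} y x^{a₁} y x^{a₂} y x^{a₃} y` (`aᵢ < n`, length `≤ 4n`) are linearly independent on `M₅(ℂ)²`
(evaluate at `x = diag(s)`, `y =` the 5-cycle: entry `(0,4)` is the monomial `s₀^{a₀}s₁^{a₁}s₂^{a₂}s₃^{a₃}`). -/
theorem stub_window_functions_lower (n : ℕ) :
    (n : ℝ) ^ (4 : ℕ) ≤ (Module.finrank ℂ (Submodule.span ℂ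
      {f : (Fin 2 → Matrix (Fin 5) (Fin 5) ℂ) → Matrix (Fin 5) (Fin 5) ℂ |
        ∃ w : List (Fin 2), w.length ≤ 2 * (2 * n) ∧ f = fun B => (w.map B).prod}) : ℝ) := by
  sorry

/-- `TightWindows` is false: at `k = 5`, `ε = 1` the corner pair generates in degree `2n`, carries
the whole window `4n`, and its window has dimension `≥ n⁴ > n³` for `n ≥ 2`. (Typed target for the
refuter lane; proof = the stubs above + `Real.rpow_natCast`.) -/
theorem tightWindows_false_of_corner : ¬ TightWindows := by
  sorry

end Summit.MatrixMultiplication.MatrixMultiplication.Cruxes.LongMasquerade.FivePointCorner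

/-!
## Card 2 (`twisted-atoms`, for the TIGHT / few-point restatement the tenure planner will need once
## `TightWindows` falls): few-point masquerades = linear shadows of the semisimple algebra
## `⊕^N M_k` on the window; their trace functional is a TWISTED atomic functional
## `τ(w) = Σ_t tr(M_t · w(B_t))`, tracial on the window only.
-/

namespace Summit.MatrixMultiplication.MatrixMultiplication.Cruxes.LongMasquerade.TwistedAtoms

open scoped BigOperators
open Matrix
open Summit.MatrixMultiplication.MatrixMultiplication.Theses.MatrixPointInterpolation

/-- `FewPoint n k d N A`: evaluation at `A` on words of length `≤ 2d` factors through `N` points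
of `M_k(ℂ)²` (exactly the hypothesis shape consumed by the proved `InterpolationLemma`). -/
def FewPoint (n k d N : ℕ) (A : Fin 2 → Matrix (Fin n) (Fin n) ℂ) : Prop :=
  ∃ B : Fin N → Fin 2 → Matrix (Fin k) (Fin k) ℂ,
    ∀ (T : Finset (List (Fin 2))) (c : List (Fin 2) → ℂ), (∀ w ∈ T, w.length ≤ 2 * d) →
      (∀ t : Fin N, (∑ w ∈ T, c w • (w.map (B t)).prod) = 0) →
      (∑ w ∈ T, c w • (w.map A).prod) = 0

/-- Proposed successor crux (what `closes` actually consumes from `TightWindows ∧ PointCount`):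
TIGHT FEW-POINT MASQUERADES — generation in degree `d` plus factorisation of the window through
`N ≤ n^(2+ε)` points of size `k`, `n` unbounded, `k` fixed. -/
def TightFewPointMasquerade : Prop :=
  ∃ k : ℕ, 2 ≤ k ∧ ∀ ε : ℝ, 0 < ε → ∀ n₀ : ℕ, ∃ (n d N : ℕ) (A : Fin 2 → Matrix (Fin n) (Fin n) ℂ),
    n₀ ≤ n ∧ (N : ℝ) ≤ (n : ℝ) ^ ((2 : ℝ) + ε) ∧
    Submodule.span ℂ {M : Matrix (Fin n) (Fin n) ℂ |
      ∃ w : List (Fin 2), w.length ≤ d ∧ (w.map A).prod = M} = ⊤ ∧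
    FewPoint n k d N A

/-- FIRST LEMMA (linear algebra: row-space containment ⟺ factorisation): the few-point property
is a LINEAR SHADOW `Ψ : ⊕^N M_k → M_n` of the semisimple algebra on words of length `≤ 2d`. -/
theorem stub_fewPoint_iff_shadow (n k d N : ℕ) (A : Fin 2 → Matrix (Fin n) (Fin n) ℂ) :
    FewPoint n k d N A ↔
      ∃ (B : Fin N → Fin 2 → Matrix (Fin k) (Fin k) ℂ)
        (Ψ : (Fin N → Matrix (Fin k) (Fin k) ℂ) →ₗ[ℂ] Matrix (Fin n) (Fin n) ℂ),
        ∀ w : List (Fin 2), w.length ≤ 2 * d →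
          (w.map A).prod = Ψ (fun t => (w.map (B t)).prod) := by
  sorry

/-- WINDOWED TRACIALITY (the equation the twist must solve): with `M := ` the Riesz vector of
`tr ∘ Ψ`, the twisted atomic functional `τ(w) = Σ_t tr(M_t · w(B_t))` is a trace on the window. -/
theorem stub_windowed_traciality (n k d N : ℕ) (A : Fin 2 → Matrix (Fin n) (Fin n) ℂ)
    (B : Fin N → Fin 2 → Matrix (Fin k) (Fin k) ℂ)
    (Ψ : (Fin N → Matrix (Fin k) (Fin k) ℂ) →ₗ[ℂ] Matrix (Fin n) (Fin n) ℂ)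
    (hΨ : ∀ w : List (Fin 2), w.length ≤ 2 * d →
      (w.map A).prod = Ψ (fun t => (w.map (B t)).prod)) :
    ∃ M : Fin N → Matrix (Fin k) (Fin k) ℂ, ∀ u v : List (Fin 2), u.length + v.length ≤ 2 * d →
      (∑ t, Matrix.trace (M t * ((u ++ v).map (B t)).prod)) =
        ∑ t, Matrix.trace (M t * ((v ++ u).map (B t)).prod) := by
  sorry

/-- THE OPERATIVE DIRECTION (construct a functional ⇒ get the masquerade): if the trace functional
of a pair generating in degree `d` is TWISTED ATOMIC up to degree `3d` — `tr w(A) = Σ_t tr(M_t · w(B_t))`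
for `N` points `B_t ∈ M_k²` and twists `M_t ∈ M_k` — then evaluation at `A` factors through the points
on the window `2d` (pair `f` with `|v| ≤ d` and use non-degeneracy of `tr` on `M_n = W_d`). -/
theorem stub_fewPoint_of_twistedTrace (n k d N : ℕ) (A : Fin 2 → Matrix (Fin n) (Fin n) ℂ)
    (hgen : Submodule.span ℂ {M : Matrix (Fin n) (Fin n) ℂ |
      ∃ w : List (Fin 2), w.length ≤ d ∧ (w.map A).prod = M} = ⊤)
    (B : Fin N → Fin 2 → Matrix (Fin k) (Fin k) ℂ) (M : Fin N → Matrix (Fin k) (Fin k) ℂ)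
    (htr : ∀ w : List (Fin 2), w.length ≤ 3 * d →
      Matrix.trace ((w.map A).prod) = ∑ t, Matrix.trace (M t * (w.map (B t)).prod)) :
    FewPoint n k d N A := by
  sorry

/-- The re-glue the tenure planner needs (both inputs exist: `InterpolationLemma` is PROVED in the
tree, item 18941): tight few-point masquerades multiply matrices. -/
theorem closes_of_tightFewPoint (h : TightFewPointMasquerade) (hI : InterpolationLemma) :
    _root_.MatrixMultiplication := by
  sorry

end Summit.MatrixMultiplication.MatrixMultiplication.Cruxes.LongMasquerade.TwistedAtoms
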